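import Summits.CriticalPhenomena.PercolationContinuityZ3.Theorems.PercNearOneGluingNoHeavyLowerTailCubicThreePointInduction
import Summits.CriticalPhenomena.PercolationContinuityZ3.Theorems.PercNearOneGluingNoHeavyLowerTailCubicThreePointApexRefined
import Summits.CriticalPhenomena.PercolationContinuityZ3.Theorems.PercNearOneGluingNoHeavyLowerTailCubicThreePointApexStep
import HarnessLib

/-!
# `NoHeavyLowerTail` (stmt-CriticalPhenomena-4575) — `Γ ≥ 0` on every finite weighted graph from the step hypothesis at one terminal
# (the `|E|`-induction along `b`-edges for the apex-refined row; conditional theorem)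

Support file (prover prim-ineq-gen-2 gen 3, new-inequality factory; `--supports stmt-CriticalPhenomena-4575`).  Finitary weighted-cube calculus of
`…CubicThreePointSections/Induction` (prim-ineq-prove-2: configurations `S ⊆ D`, forced edges `K`, `PrW`, `PrW_split`, `frozen_iff`), the refined
events of `…ApexRefined` (`evN, evM, evNp, evW`) and the step algebra of `…ApexStep` (`GamR`, `GamB`, `GamR_segment_nonneg`).  No named facts, no sorries.

THE ROW.  `Γ := AG − u₃·(n + n′) = P(a|b|c)P(abc) − P(ab|c)P(ac|b) − P(bc|a)·[P(ab|c)+P(ac|b)+n+n′]` (apex `a`; `n = P(abc ∧ b≁c in ω∖a)`,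
`n′ = P(a|b|c ∧ V(C_a) separates b,c in the support)`), Gladkov's `AG ≥ 0` sharpened by its exact star and triangle defects; `Γ ≥ 0` has 0 violations
on ALL weighted graphs with `≤ 8` vertices (ttrl2 `hms`, 39.2·10⁶ exact evaluations) and, with the regime pair, gives the sharp cubic row `Hmax3`
(`…ApexSplit`).  Here: `GamW E D p K a b c` = `Γ` of the weighted law with support `E` for the separating cell (`GamW_eq`, `GamW_eq_Gam`);
support monotonicity `GamW_mono_support`.

THE STEP HYPOTHESIS `StepHypB V`: for every `(D, K, p ∈ [0,1], a, b, c)` and every edge `e = {x,m}`, `x ≠ m`, `x` forced-joined to `b`, the chord defect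
`Φ_e = Γ(x⁰,x¹)+Γ(x¹,x⁰)−Γ(x⁰)−Γ(x¹)` (`PhiW`) between the refined laws with forced sets `K` and `K ∪ {e}` (support `D ∪ K ∪ {e}`) is `≥ 0`.  In
transition masses (`…ApexStep.Phi_bEdge`) this is `(α₁+β₁)γ₁ᴹ + α₃γ₃ + β₁γ₃ + α₃γ₂ᴺ + γ₁ᴹ(γ₂ᴺ+γ₂ᴹ) + α₃α₁ + γ₃(γ₁ᴹ+γ₂ᴹ) + γ₃δ ≥ α₃δ`: for `m` glued to
`c` it is van den Berg–Häggström–Kahn's conditional negative correlation (RSA 2006, Thm 1.4: `u₁u₂ ≥ q·n`), for `m` glued to `a` it is trivial (`α₃ = δ = 0`),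
for Steiner `m` it is LEMMA B — OPEN; the hypothesis as a whole has 0 violations in ttrl2's exhaustive step census (8 537 844 terminal-incident
edge steps on all weighted graphs `n ≤ 7`, 21 weight families; Steiner–Steiner and apex–Steiner edges DO violate it, which is why the induction
peels only at `b`).

THEOREM (`gamW_nonneg_of_stepHypB`, `gamma_of_stepHypB`): `StepHypB V → ∀ D K p ∈ [0,1] a b c, 0 ≤ Γ(law)`.  Proof: strong induction on `|D|`.  If a
non-loop random edge `e` touches the forced cluster of `b`, `step_b`: split the seven refined masses along `e` (`PrW_split`; the sections are the
refined cells of `K` and of `K ∪ {e}` with the SAME support, `sect_ev*`), bound the closed section below by the minor with the smaller support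
(`GamW_mono_support`, induction hypothesis for `(D∖e, K)`), identify the forced section with the minor `(D∖e, K∪{e})`, and conclude with Gladkov's
chord inequality `Γ(x_p) = (1−p)Γ(x⁰) + pΓ(x¹) + p(1−p)Φ ≥ 0`.  Otherwise `b` is frozen and `Γ = 0` (`GamW_eq_zero_of_frozen_b`: `a` glued to `b`,
or `c` glued to `b`, or `b` isolated — every product in `Γ` has a vanishing factor).
Memo: run/shared/lean/prim/prim-ineq-gen-2/HMAX-SPLIT.md §6–§9; census run/shared/lean/ttrl/hms/README.md (step tables).
[cite: Gladkov2024StrongFKG, §2 (the quadratic-in-`p` induction step)]; [cite: GladkovZimin2024HK, §4 (one-coordinate decomposition, forced edges)]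
-/

noncomputable section

namespace Summit.CriticalPhenomena.PercolationContinuityZ3.Theorems

namespace CubicThreePointApex

open Finset SimpleGraph Literature.Probability.Percolation.DecisionTree CubicThreePointStep CubicThreePointTerminal

variable {V : Type*} [DecidableEq V]

/-! ### `Γ` on the weighted law, with explicit support -/

/-- `Γ` in the seven refined cells of the weighted three-point law (random edges `D`, weights `p`, forced edges `K`, apex `a`),
the separating cell `N′` being taken with respect to the support graph `E`. [folklore] -/
def GamW (E D : Finset (Sym2 V)) (p : Sym2 V → ℝ) (K : Finset (Sym2 V)) (a b c : V) : ℝ :=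
  GamR (PrW D p (evW E K a b c)) (PrW D p (evNp E K a b c)) (PrW D p (evU₁ K a b c)) (PrW D p (evU₂ K a b c))
    (PrW D p (evU₃ K a b c)) (PrW D p (evN K a b c)) (PrW D p (evM K a b c))

/-- `Γ = q·t − u₁u₂ − u₃(u₁ + u₂ + n + n′)` on the weighted law. [folklore] -/
theorem GamW_eq (E D : Finset (Sym2 V)) (p : Sym2 V → ℝ) (K : Finset (Sym2 V)) (a b c : V) :
    GamW E D p K a b c =
      PrW D p (evQ K a b c) * PrW D p (evT K a b c) - PrW D p (evU₁ K a b c) * PrW D p (evU₂ K a b c) -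
        PrW D p (evU₃ K a b c) *
          (PrW D p (evU₁ K a b c) + PrW D p (evU₂ K a b c) + PrW D p (evN K a b c) + PrW D p (evNp E K a b c)) := by
  rw [PrW_evQ D p E K a b c, PrW_evT D p K a b c]
  simp only [GamW, GamR]
  ring

/-- `GamW` is the row `Γ = AG − u₃(n + n′)` of `…ApexSplit` evaluated on the weighted law. [folklore] -/
theorem GamW_eq_Gam (E D : Finset (Sym2 V)) (p : Sym2 V → ℝ) (K : Finset (Sym2 V)) (a b c : V) :
    GamW E D p K a b c =
      Gam (PrW D p (evQ K a b c)) (PrW D p (evU₁ K a b c)) (PrW D p (evU₂ K a b c)) (PrW D p (evU₃ K a b c))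
        (PrW D p (evT K a b c)) (PrW D p (evN K a b c)) (PrW D p (evNp E K a b c)) := by
  rw [GamW_eq]
  simp only [Gam, AG]
  ring

/-- Enlarging the support can only increase `Γ` (it lowers `n′`, whose coefficient is `−u₃ ≤ 0`). [folklore] -/
theorem GamW_mono_support (D : Finset (Sym2 V)) {p : Sym2 V → ℝ} (hp0 : ∀ i, 0 ≤ p i) (hp1 : ∀ i, p i ≤ 1)
    {E E' : Finset (Sym2 V)} (hE : E ⊆ E') (K : Finset (Sym2 V)) (a b c : V) :
    GamW E D p K a b c ≤ GamW E' D p K a b c := by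
  rw [GamW_eq, GamW_eq]
  have h1 := PrW_evNp_anti D hp0 hp1 hE K a b c
  have h2 : 0 ≤ PrW D p (evU₃ K a b c) := PrW_nonneg D hp0 hp1 _
  nlinarith [mul_le_mul_of_nonneg_left h1 h2]

/-- The CHORD DEFECT `Φ_e = Γ(x⁰,x¹) + Γ(x¹,x⁰) − Γ(x⁰) − Γ(x¹)` of the one-edge segment between the refined laws with forced sets `K`
(edge closed) and `K'` (edge forced), both with support `E`. [folklore] -/
def PhiW (E D : Finset (Sym2 V)) (p : Sym2 V → ℝ) (K K' : Finset (Sym2 V)) (a b c : V) : ℝ :=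
  GamB (PrW D p (evW E K a b c)) (PrW D p (evNp E K a b c)) (PrW D p (evU₁ K a b c)) (PrW D p (evU₂ K a b c))
      (PrW D p (evU₃ K a b c)) (PrW D p (evN K a b c)) (PrW D p (evM K a b c))
      (PrW D p (evW E K' a b c)) (PrW D p (evNp E K' a b c)) (PrW D p (evU₁ K' a b c)) (PrW D p (evU₂ K' a b c))
      (PrW D p (evU₃ K' a b c)) (PrW D p (evN K' a b c)) (PrW D p (evM K' a b c)) +
    GamB (PrW D p (evW E K' a b c)) (PrW D p (evNp E K' a b c)) (PrW D p (evU₁ K' a b c)) (PrW D p (evU₂ K' a b c))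
      (PrW D p (evU₃ K' a b c)) (PrW D p (evN K' a b c)) (PrW D p (evM K' a b c))
      (PrW D p (evW E K a b c)) (PrW D p (evNp E K a b c)) (PrW D p (evU₁ K a b c)) (PrW D p (evU₂ K a b c))
      (PrW D p (evU₃ K a b c)) (PrW D p (evN K a b c)) (PrW D p (evM K a b c)) -
    GamW E D p K a b c - GamW E D p K' a b c

/-! ### The step hypothesis (LEMMA B + BHK on `bc`-edges + the trivial `ab`-edges), and the step -/

/-- **Step hypothesis at the terminal `b`.**  For every random-edge set `D`, forced set `K`, weights `p ∈ [0,1]`, terminals `a, b, c` and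
edge `e = {x, m}` (`x ≠ m`, `x` forced-joined to `b`), the chord defect `Φ_e` of the row `Γ` (apex `a`) between the laws with forced sets
`K` and `K ∪ {e}` — the separating cell `N′` taken in the support `D ∪ K ∪ {e}` — is nonnegative.  By `…ApexStep.Phi_bEdge` this is
`(α₁+β₁)γ₁ᴹ + α₃γ₃ + β₁γ₃ + α₃γ₂ᴺ + γ₁ᴹ(γ₂ᴺ+γ₂ᴹ) + α₃α₁ + γ₃(γ₁ᴹ+γ₂ᴹ) + γ₃δ ≥ α₃δ` in transition masses; for `m` in the cluster of `c` it
is van den Berg–Häggström–Kahn's Thm 1.4 (RSA 2006), for `m` in the cluster of `a` it is trivial, for Steiner `m` it is LEMMA B (open);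
0 violations in ttrl2's exhaustive census (8.54·10⁶ terminal-incident edge steps, all weighted graphs `n ≤ 7`, 21 weight families). [folklore] -/
def StepHypB (V : Type*) [DecidableEq V] : Prop :=
  ∀ (D K : Finset (Sym2 V)) (p : Sym2 V → ℝ), (∀ i, 0 ≤ p i) → (∀ i, p i ≤ 1) →
    ∀ (a b c x m : V), x ≠ m → (∀ S : Finset (Sym2 V), R K S b x) →
      0 ≤ PhiW (insert s(x, m) (D ∪ K)) D p K (insert s(x, m) K) a b c

/-! ### Frozen `b`: no random edge touches the forced cluster of `b` -/

/-- If no non-loop random edge touches the forced cluster of `b`, then `Γ = 0` (the law is degenerate from `b`'s side: either `a`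
or `c` is glued to `b`, or `b` is isolated; in each case every product in `Γ` has a vanishing factor). [folklore] -/
theorem GamW_eq_zero_of_frozen_b (E D : Finset (Sym2 V)) (p : Sym2 V → ℝ) (K : Finset (Sym2 V)) (a b c : V)
    (hb : ∀ e ∈ D, ∀ y z : V, e = s(y, z) → y ≠ z → ¬ R K ∅ b y) :
    GamW E D p K a b c = 0 := by
  have eb : ∀ S, S ⊆ D → ∀ y, (R K S b y ↔ R K ∅ b y) := fun S hS y => frozen_iff hb hS y
  unfold GamW
  by_cases Pab : R K ∅ b a
  · -- `a` glued to `b`: `W = N′ = u₂ = u₃ = 0`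
    have hab : ∀ S, S ⊆ D → R K S a b := fun S hS => ((eb S hS a).2 Pab).symm
    rw [PrW_eq_zero_of_forall D p (fun S hS h => h.1.1 (hab S hS)),
      PrW_eq_zero_of_forall D p (fun S hS h => h.1.1 (hab S hS)),
      PrW_eq_zero_of_forall D p (fun S hS (h : S ∈ evU₂ K a b c) => h.2 (hab S hS)),
      PrW_eq_zero_of_forall D p (fun S hS (h : S ∈ evU₃ K a b c) => h.2 (hab S hS))]
    simp only [GamR]; ring
  · by_cases Pbc : R K ∅ b c
    · -- `c` glued to `b`, `a` not: everything is `bc|a`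
      have hbc : ∀ S, S ⊆ D → R K S b c := fun S hS => (eb S hS c).2 Pbc
      have hab : ∀ S, S ⊆ D → ¬ R K S a b := fun S hS h => Pab ((eb S hS a).1 h.symm)
      have hac : ∀ S, S ⊆ D → ¬ R K S a c := fun S hS h => hab S hS (h.trans (hbc S hS).symm)
      rw [PrW_eq_zero_of_forall D p (fun S hS h => h.1.2.2 (hbc S hS)),
        PrW_eq_zero_of_forall D p (fun S hS h => h.1.2.2 (hbc S hS)),
        PrW_eq_zero_of_forall D p (fun S hS (h : S ∈ evU₁ K a b c) => hab S hS h.1),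
        PrW_eq_zero_of_forall D p (fun S hS (h : S ∈ evU₂ K a b c) => hac S hS h.1),
        PrW_eq_zero_of_forall D p (fun S hS (h : S ∈ evN K a b c) => hab S hS h.1),
        PrW_eq_zero_of_forall D p (fun S hS (h : S ∈ evM K a b c) => hab S hS h.1)]
      simp only [GamR]; ring
    · -- `b` isolated: `u₁ = u₃ = n = m = 0`
      have hab : ∀ S, S ⊆ D → ¬ R K S a b := fun S hS h => Pab ((eb S hS a).1 h.symm)
      have hbc : ∀ S, S ⊆ D → ¬ R K S b c := fun S hS h => Pbc ((eb S hS c).1 h)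
      rw [PrW_eq_zero_of_forall D p (fun S hS (h : S ∈ evU₁ K a b c) => hab S hS h.1),
        PrW_eq_zero_of_forall D p (fun S hS (h : S ∈ evU₃ K a b c) => hbc S hS h.1),
        PrW_eq_zero_of_forall D p (fun S hS (h : S ∈ evN K a b c) => hab S hS h.1),
        PrW_eq_zero_of_forall D p (fun S hS (h : S ∈ evM K a b c) => hab S hS h.1)]
      simp only [GamR]; ring


section Induction

variable {p : Sym2 V → ℝ} (hp0 : ∀ i, 0 ≤ p i) (hp1 : ∀ i, p i ≤ 1)
include hp0 hp1

/-- **The step at `b`.**  If `e = {x,m} ∈ D`, `x ≠ m`, `x` is forced-joined to `b`, `Γ ≥ 0` holds for the minors `(D ∖ e, K)` and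
`(D ∖ e, K ∪ {e})` (each with its own support), and the step hypothesis holds, then `Γ ≥ 0` for `(D, K)` with support `D ∪ K`:
one-edge split of the seven refined masses, sections = forcing (`sect_ev*`), support monotonicity for the closed minor, and Gladkov's
chord inequality `GamR_segment_nonneg`. [folklore] -/
theorem step_b (hstep : StepHypB V) {D K : Finset (Sym2 V)} {a b c x m : V} (hxm : x ≠ m)
    (hbx : ∀ S : Finset (Sym2 V), R K S b x) (he : s(x, m) ∈ D)
    (ih0 : 0 ≤ GamW (D.erase s(x, m) ∪ K) (D.erase s(x, m)) p K a b c)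
    (ih1 : 0 ≤ GamW (D.erase s(x, m) ∪ insert s(x, m) K) (D.erase s(x, m)) p (insert s(x, m) K) a b c) :
    0 ≤ GamW (D ∪ K) D p K a b c := by
  set e := s(x, m) with he_def
  set D' := D.erase e with hD'
  have heD' : e ∉ D' := Finset.notMem_erase e D
  have hD : D = insert e D' := (Finset.insert_erase he).symm
  set E := D ∪ K with hE_def
  have hE : E = insert e (D' ∪ K) := by rw [hE_def, hD, Finset.insert_union]
  have hE1 : D' ∪ insert e K = E := by rw [hE, Finset.union_insert]
  have hsub : D' ∪ K ⊆ E := by rw [hE]; exact Finset.subset_insert _ _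
  -- the seven masses of `(D, K)` as convex combinations of the two sections
  have sW : PrW D p (evW E K a b c) = (1 - p e) * PrW D' p (evW E K a b c) + p e * PrW D' p (evW E (insert e K) a b c) := by
    rw [hD, PrW_split D' p heD', sect_evW]
  have sNp : PrW D p (evNp E K a b c) = (1 - p e) * PrW D' p (evNp E K a b c) + p e * PrW D' p (evNp E (insert e K) a b c) := by
    rw [hD, PrW_split D' p heD', sect_evNp]
  have s1 : PrW D p (evU₁ K a b c) = (1 - p e) * PrW D' p (evU₁ K a b c) + p e * PrW D' p (evU₁ (insert e K) a b c) := by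
    rw [hD, PrW_split D' p heD', sect_evU₁]
  have s2 : PrW D p (evU₂ K a b c) = (1 - p e) * PrW D' p (evU₂ K a b c) + p e * PrW D' p (evU₂ (insert e K) a b c) := by
    rw [hD, PrW_split D' p heD', sect_evU₂]
  have s3 : PrW D p (evU₃ K a b c) = (1 - p e) * PrW D' p (evU₃ K a b c) + p e * PrW D' p (evU₃ (insert e K) a b c) := by
    rw [hD, PrW_split D' p heD', sect_evU₃]
  have sN : PrW D p (evN K a b c) = (1 - p e) * PrW D' p (evN K a b c) + p e * PrW D' p (evN (insert e K) a b c) := by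
    rw [hD, PrW_split D' p heD', sect_evN]
  have sM : PrW D p (evM K a b c) = (1 - p e) * PrW D' p (evM K a b c) + p e * PrW D' p (evM (insert e K) a b c) := by
    rw [hD, PrW_split D' p heD', sect_evM]
  -- the three ingredients of the chord inequality
  have h0 : 0 ≤ GamW E D' p K a b c := le_trans ih0 (GamW_mono_support D' hp0 hp1 hsub K a b c)
  have h1 : 0 ≤ GamW E D' p (insert e K) a b c := by rw [← hE1]; exact ih1
  have hΦ : 0 ≤ PhiW E D' p K (insert e K) a b c := by rw [hE]; exact hstep D' K p hp0 hp1 a b c x m hxm hbx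
  unfold GamW
  rw [sW, sNp, s1, s2, s3, sN, sM]
  unfold PhiW GamW at hΦ
  unfold GamW at h0 h1
  exact GamR_segment_nonneg (hp0 e) (hp1 e) h0 h1 hΦ

/-! ### The induction -/

/-- **`Γ ≥ 0` for every finite weighted graph, from the step hypothesis at `b`** (strong induction on the number of random edges: while some
non-loop random edge touches the forced cluster of `b`, peel it with `step_b`; otherwise `Γ = 0`). [folklore] -/
theorem gamW_nonneg_of_stepHypB (hstep : StepHypB V) :
    ∀ (n : ℕ) (D K : Finset (Sym2 V)) (a b c : V), D.card = n → 0 ≤ GamW (D ∪ K) D p K a b c := by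
  intro n
  induction n using Nat.strong_induction_on with
  | _ n ih =>
  intro D K a b c hDn
  by_cases hex : ∃ e ∈ D, ∃ y z : V, e = s(y, z) ∧ y ≠ z ∧ R K ∅ b y
  · obtain ⟨e, heD, y, z, rfl, hyz, hreach⟩ := hex
    have hlt : (D.erase s(y, z)).card < n := by rw [← hDn]; exact Finset.card_erase_lt_of_mem heD
    have IH : ∀ (K' : Finset (Sym2 V)), 0 ≤ GamW (D.erase s(y, z) ∪ K') (D.erase s(y, z)) p K' a b c :=
      fun K' => ih _ hlt _ K' a b c rfl
    exact step_b hp0 hp1 hstep hyz (fun S => R_mono_config (Finset.empty_subset S) hreach) heD (IH _) (IH _)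
  · push Not at hex
    have hb : ∀ e ∈ D, ∀ y z : V, e = s(y, z) → y ≠ z → ¬ R K ∅ b y :=
      fun e he y z hyz hne => hex e he y z hyz hne
    rw [GamW_eq_zero_of_frozen_b (D ∪ K) D p K a b c hb]

/-- **THEOREM (conditional).**  Under the step hypothesis at `b` — LEMMA B for `b–Steiner` edges, van den Berg–Häggström–Kahn for `bc`-edges,
trivial for `ab`-edges; census-validated as a whole — the apex-refined row holds on every finite weighted graph:
`Γ = P(a|b|c)P(abc) − P(ab|c)P(ac|b) − P(bc|a)·[P(ab|c) + P(ac|b) + n + n′] ≥ 0`, with `n = P(abc ∧ b≁c in ω∖a)` and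
`n′ = P(a|b|c ∧ V(C_a) separates b,c in the support D ∪ K)`; i.e. Gladkov's `AG ≥ 0` sharpened by its exact star and triangle defects.
With the regime pair (or a valid `S₄,ₖ`) this gives `Hmax3` (`…ApexSplit`). [folklore] -/
theorem gamma_of_stepHypB (hstep : StepHypB V) (D K : Finset (Sym2 V)) (a b c : V) :
    0 ≤ Gam (PrW D p (evQ K a b c)) (PrW D p (evU₁ K a b c)) (PrW D p (evU₂ K a b c)) (PrW D p (evU₃ K a b c))
        (PrW D p (evT K a b c)) (PrW D p (evN K a b c)) (PrW D p (evNp (D ∪ K) K a b c)) := by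
  rw [← GamW_eq_Gam]
  exact gamW_nonneg_of_stepHypB hp0 hp1 hstep D.card D K a b c rfl

end Induction

end CubicThreePointApex

end Summit.CriticalPhenomena.PercolationContinuityZ3.Theorems
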